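import Literature.MathematicalPhysics.StatisticalMechanics.MuGroundStateConfiguration
import Summits.AtomisticToContinuum.Crystallization.Theorems.ChargedEnergyGap.Negative.BlocksBound
import Summits.AtomisticToContinuum.Crystallization.Theorems.LayeredLawsSelectHcp.Negative.PeriodicEnergy
import Summits.AtomisticToContinuum.Crystallization.Theses.GrainCoreNetworkSplit

/-!
# FrustratedLawDichotomy · crux `AperiodicFrustratedLawGap` (stmt-AtomisticToContinuum-27623) — CERTIFIED FINITE-SURGERY TESTS
# (the `k`-atom census instruments of the surgery currency; decomp-a2c, prover hand 2, structural share, generation 5)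

Companion of `FrustratedLawDichotomyAperiodicGapGSCDoor`: there the crux (by name) was reduced to the μ-equilibrium door
`GrainCoreNetworkSplit.MuEquilibriumDoor` (item 27073) and the law-free residual «no textured Nash rooted hard-core configuration is an
`e⋆`-μGSC».  Here the μGSC notion (`Literature…IsMuGSC`, Sütő 2006 §2: no finite surgery «remove the `n` atoms `xf`, insert the `k` atoms `R`»
lowers `U − μ·#`) is SPECIALISED to the finite tests a census can run against an explicit configuration:

§1 (any potential `V`, any `μ`, any dimension) — `surgery_le_of_isMuGSC` (`μ·(k − n) ≤ Δ`, `Δ = [U(R) + I(R, X∖xf)] − [U(xf) + I(xf, X∖xf)]`),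
   `removal_le_of_isMuGSC` (`k = 0`: every finite cluster `C ⊆ X` has `U(C) + I(C, X∖C) ≤ μ·|C|` — the `k`-atom BINDING FLOOR, generalising
   the one-atom binding floor of generation 4), `rearrangement_le_of_isMuGSC` (`k = n`: no particle-conserving rearrangement lowers the energy —
   the `k`-atom NASH property; `μ` cancels), and the contrapositive `not_isMuGSC_of_profitable_surgery`.
§2 (Lennard-Jones at `μ = e⋆ = ⨅_Q e(Q)`) — `e⋆` is known only from ABOVE (`e⋆ ≤ e(Q)` for every periodic `Q`, tree lemma
   `ChargedEnergyGapNegative.eStar_le`); a surgery with NO NET INSERTION (`k ≤ n`) whose energy balance beats `e_up·(k − n)` for some periodic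
   witness `e(Q) ≤ e_up` refutes `IsMuGSC lennardJones e⋆ X` (`not_isMuGSC_eStar_of_netRemoval`; cases `k = 0`:
   `not_isMuGSC_eStar_of_underboundCluster`, `k = n`: `not_isMuGSC_of_profitable_rearrangement`, which is even `e⋆`-free).  Net insertions
   (`k > n`) would need `e⋆` from below and are NOT certifiable — this is why the surgery currency beats every «local energy > e⋆ + κ» residual.
§3 (periodic candidates, granted the door) — `isMuGSC_view_of_energyPerParticle_le`: an exact periodic minimiser (`δ`-separated periodic `Q`
   with `e(Q) ≤ e⋆`) is, seen from every motif point, an `e⋆`-μGSC; census form `eStar_lt_energyPerParticle_of_surgery`: ANY finite surgery on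
   `Q − x` with balance `Δ < e(Q)·(k − n)` certifies `e⋆ < e(Q)` — no bound on `e⋆` whatsoever is needed (if `e(Q) ≤ e⋆` then `e(Q) = e⋆`).
   This is the `k`-atom generalisation (door-conditional) of the unconditional one-atom census filters
   `FrustratedLawDichotomyBindingFloor.eStar_lt_energyPerParticle_of_looseSite / _of_deepHole` (generation 4).

All `[folklore]` given Sütő's definition; the door is item 27073 (tree-proved as `EquilibriumInLaw.stub_equilibriumInLaw`, farm build pending).
-/

noncomputable section

namespace Summit.AtomisticToContinuum.Crystallization.Theorems.FrustratedLawDichotomyGSCSurgeryTests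

open MeasureTheory
open Literature.MathematicalPhysics.StatisticalMechanics
open Literature.Probability.Process (count_restrict_singleton_ne_zero_iff)
open Summit.AtomisticToContinuum.Crystallization.Theorems.ChargedEnergyGapNegative (E3 eStar eStar_le)
open Summit.AtomisticToContinuum.Crystallization.Theorems.LayeredLawsSelectHcp.Negative.PeriodicPalmLaw
  (palmLaw view viewMeasure rooted_palmLaw pointStationary_palmLaw of_ae_palmLaw)
open Summit.AtomisticToContinuum.Crystallization.Theorems.LayeredLawsSelectHcp.Negative.PeriodicEnergy (meanRootEnergy_palmLaw)

/-! ## §1. Surgery bookkeeping for a `μ`GSC (any potential, any chemical potential, any dimension) -/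

section General

variable {d : ℕ} {V : ℝ → ℝ} {μ : ℝ} {X : Set (EuclideanSpace ℝ (Fin d))}

/-- **Surgery balance of a `μ`GSC**: removing the `n` distinct atoms `xf ⊆ X` and inserting the `k` distinct atoms `R` (off `X ∖ xf`) has
energy balance `Δ = [U(R) + I(R, X∖xf)] − [U(xf) + I(xf, X∖xf)] ≥ μ·(k − n)`. [cite: Suto2006, §2 Definition (μGSC, second form)] -/
theorem surgery_le_of_isMuGSC (h : IsMuGSC V μ X) {n : ℕ} {xf : Fin n → EuclideanSpace ℝ (Fin d)}
    (hxf : Function.Injective xf) (hX : Set.range xf ⊆ X) {k : ℕ} {R : Fin k → EuclideanSpace ℝ (Fin d)}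
    (hR : Function.Injective R) (hdisj : Disjoint (Set.range R) (X \ Set.range xf)) :
    μ * ((k : ℝ) - n) ≤
      (interactionEnergy V R + ∑ i, ∑' y : ↥(X \ Set.range xf), V (dist (R i) y)) -
        (interactionEnergy V xf + ∑ i, ∑' y : ↥(X \ Set.range xf), V (dist (xf i) y)) := by
  have := h.le hxf hX hR hdisj
  rw [mul_sub]
  linarith

/-- The field terms of an empty insertion vanish. [folklore] -/
theorem sum_field_fin_zero (R : Fin 0 → EuclideanSpace ℝ (Fin d)) (Y : Set (EuclideanSpace ℝ (Fin d))) :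
    (∑ i, ∑' y : ↥Y, V (dist (R i) y)) = 0 :=
  Finset.sum_of_isEmpty _

/-- **`k`-ATOM BINDING FLOOR** (removal test, `k = 0`): in a `μ`GSC every finite cluster `xf` of `n` distinct atoms satisfies
`U(xf) + I(xf, X ∖ xf) ≤ μ·n` — the cluster is bound to the rest by at least `|μ|·n` beyond its internal energy. [cite: Suto2006, §2 Definition (μGSC), removal] -/
theorem removal_le_of_isMuGSC (h : IsMuGSC V μ X) {n : ℕ} {xf : Fin n → EuclideanSpace ℝ (Fin d)}
    (hxf : Function.Injective xf) (hX : Set.range xf ⊆ X) :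
    interactionEnergy V xf + ∑ i, ∑' y : ↥(X \ Set.range xf), V (dist (xf i) y) ≤ μ * n := by
  have hR : Function.Injective (fun i : Fin 0 => i.elim0 : Fin 0 → EuclideanSpace ℝ (Fin d)) := fun i => i.elim0
  have hdisj : Disjoint (Set.range (fun i : Fin 0 => i.elim0 : Fin 0 → EuclideanSpace ℝ (Fin d))) (X \ Set.range xf) := by
    rw [Set.range_eq_empty]
    exact Set.empty_disjoint _
  have key := h.le hxf hX hR hdisj
  have h0 : interactionEnergy V (fun i : Fin 0 => (i.elim0 : EuclideanSpace ℝ (Fin d))) = 0 :=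
    interactionEnergy_of_subsingleton V _
  rw [h0, sum_field_fin_zero] at key
  simp only [Nat.cast_zero, mul_zero, zero_add, sub_zero] at key
  linarith

/-- **`k`-ATOM NASH PROPERTY** (rearrangement test, `k = n`): in a `μ`GSC no particle-conserving finite rearrangement `xf ↦ R` (new positions
distinct and off `X ∖ xf`) lowers the energy: `U(xf) + I(xf, X∖xf) ≤ U(R) + I(R, X∖xf)`; the chemical potential cancels. [cite: Suto2006, §2 Definition (μGSC), exchange] -/
theorem rearrangement_le_of_isMuGSC (h : IsMuGSC V μ X) {n : ℕ} {xf : Fin n → EuclideanSpace ℝ (Fin d)}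
    (hxf : Function.Injective xf) (hX : Set.range xf ⊆ X) {R : Fin n → EuclideanSpace ℝ (Fin d)}
    (hR : Function.Injective R) (hdisj : Disjoint (Set.range R) (X \ Set.range xf)) :
    interactionEnergy V xf + ∑ i, ∑' y : ↥(X \ Set.range xf), V (dist (xf i) y) ≤
      interactionEnergy V R + ∑ i, ∑' y : ↥(X \ Set.range xf), V (dist (R i) y) := by
  have := h.le hxf hX hR hdisj
  linarith

/-- **Contrapositive, census form**: a finite surgery with balance `Δ < μ·(k − n)` refutes the `μ`GSC property. [folklore] -/
theorem not_isMuGSC_of_profitable_surgery {n : ℕ} {xf : Fin n → EuclideanSpace ℝ (Fin d)}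
    (hxf : Function.Injective xf) (hX : Set.range xf ⊆ X) {k : ℕ} {R : Fin k → EuclideanSpace ℝ (Fin d)}
    (hR : Function.Injective R) (hdisj : Disjoint (Set.range R) (X \ Set.range xf))
    (hΔ : (interactionEnergy V R + ∑ i, ∑' y : ↥(X \ Set.range xf), V (dist (R i) y)) -
        (interactionEnergy V xf + ∑ i, ∑' y : ↥(X \ Set.range xf), V (dist (xf i) y)) < μ * ((k : ℝ) - n)) :
    ¬ IsMuGSC V μ X := fun h =>
  absurd (surgery_le_of_isMuGSC h hxf hX hR hdisj) (not_le.2 hΔ)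

/-- **`e⋆`-free census form** (`k = n`): a PROFITABLE particle-conserving rearrangement refutes the `μ`GSC property at EVERY chemical
potential. [folklore] -/
theorem not_isMuGSC_of_profitable_rearrangement {n : ℕ} {xf : Fin n → EuclideanSpace ℝ (Fin d)}
    (hxf : Function.Injective xf) (hX : Set.range xf ⊆ X) {R : Fin n → EuclideanSpace ℝ (Fin d)}
    (hR : Function.Injective R) (hdisj : Disjoint (Set.range R) (X \ Set.range xf))
    (hΔ : interactionEnergy V R + ∑ i, ∑' y : ↥(X \ Set.range xf), V (dist (R i) y) <
        interactionEnergy V xf + ∑ i, ∑' y : ↥(X \ Set.range xf), V (dist (xf i) y)) :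
    ¬ IsMuGSC V μ X := fun h =>
  absurd (rearrangement_le_of_isMuGSC h hxf hX hR hdisj) (not_le.2 hΔ)

end General

/-! ## §2. Lennard-Jones at `μ = e⋆`: tests that need only an UPPER bound on `e⋆` -/

section LennardJones

variable {X : Set E3}

/-- `e⋆ ≤ e_up` as soon as some periodic configuration has energy per particle `≤ e_up` (`e⋆` is a genuine infimum: tree lemma `eStar_le`,
item 0714). [folklore] -/
theorem eStar_le_of_witness {e_up : ℝ} (hup : ∃ Q : PeriodicConfiguration 3, Q.energyPerParticle lennardJones ≤ e_up) :
    (⨅ Q : PeriodicConfiguration 3, Q.energyPerParticle lennardJones) ≤ e_up := by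
  obtain ⟨Q, hQ⟩ := hup
  exact (eStar_le Q).trans hQ

/-- **NET-REMOVAL TEST at `μ = e⋆`.**  If removing `n` atoms `xf ⊆ X` and inserting `k ≤ n` atoms `R` has balance
`Δ < e_up·(k − n)` for some periodic witness `e(Q) ≤ e_up` (e.g. the optimally dilated hcp lattice sum), then `X` is NOT an `e⋆`-μGSC of
`V_LJ` — certified without any lower bound on `e⋆` (`e⋆·(k − n) ≥ e_up·(k − n)` because `k − n ≤ 0`). [folklore] -/
theorem not_isMuGSC_eStar_of_netRemoval {e_up : ℝ} (hup : ∃ Q : PeriodicConfiguration 3, Q.energyPerParticle lennardJones ≤ e_up)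
    {n : ℕ} {xf : Fin n → E3} (hxf : Function.Injective xf) (hX : Set.range xf ⊆ X) {k : ℕ} {R : Fin k → E3}
    (hR : Function.Injective R) (hdisj : Disjoint (Set.range R) (X \ Set.range xf)) (hkn : k ≤ n)
    (hΔ : (interactionEnergy lennardJones R + ∑ i, ∑' y : ↥(X \ Set.range xf), lennardJones (dist (R i) y)) -
        (interactionEnergy lennardJones xf + ∑ i, ∑' y : ↥(X \ Set.range xf), lennardJones (dist (xf i) y)) < e_up * ((k : ℝ) - n)) :
    ¬ IsMuGSC lennardJones (⨅ Q : PeriodicConfiguration 3, Q.energyPerParticle lennardJones) X := by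
  refine not_isMuGSC_of_profitable_surgery hxf hX hR hdisj (hΔ.trans_le ?_)
  have hkn' : ((k : ℝ) - n) ≤ 0 := by
    have : (k : ℝ) ≤ n := by exact_mod_cast hkn
    linarith
  exact mul_le_mul_of_nonpos_right (eStar_le_of_witness hup) hkn'

/-- **UNDERBOUND-CLUSTER TEST** (`k = 0`): a finite cluster `xf ⊆ X` of `n` atoms with `U(xf) + I(xf, X∖xf) > e_up·n` for a periodic witness
`e(Q) ≤ e_up` refutes `IsMuGSC lennardJones e⋆ X` — the `k`-atom version of the loose-site filter. [folklore] -/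
theorem not_isMuGSC_eStar_of_underboundCluster {e_up : ℝ} (hup : ∃ Q : PeriodicConfiguration 3, Q.energyPerParticle lennardJones ≤ e_up)
    {n : ℕ} {xf : Fin n → E3} (hxf : Function.Injective xf) (hX : Set.range xf ⊆ X)
    (hloose : e_up * n < interactionEnergy lennardJones xf + ∑ i, ∑' y : ↥(X \ Set.range xf), lennardJones (dist (xf i) y)) :
    ¬ IsMuGSC lennardJones (⨅ Q : PeriodicConfiguration 3, Q.energyPerParticle lennardJones) X := by
  intro h
  have h1 := removal_le_of_isMuGSC h hxf hX
  have h2 : (⨅ Q : PeriodicConfiguration 3, Q.energyPerParticle lennardJones) * (n : ℝ) ≤ e_up * n :=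
    mul_le_mul_of_nonneg_right (eStar_le_of_witness hup) (Nat.cast_nonneg n)
  linarith

end LennardJones

/-! ## §3. Periodic candidates: granted the door, any profitable surgery certifies `e⋆ < e(Q)` -/

section Periodic

variable (Q : PeriodicConfiguration 3)

/-- The atoms of the view measure `count|(Q − x)` are the points of `Q − x`. [folklore] -/
theorem setOf_viewMeasure_ne_zero (x : E3) : {p : E3 | viewMeasure Q x {p} ≠ 0} = view Q x :=
  Set.ext fun p => count_restrict_singleton_ne_zero_iff (view Q x) p

/-- **AN EXACT PERIODIC MINIMISER IS AN `e⋆`-μGSC (granted the door).**  If `MuEquilibriumDoor` holds and a `δ`-separated (`δ > 0`) periodic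
configuration `Q` has `e(Q) ≤ e⋆`, then for every motif point `x` the translate `Q − x` is an `e⋆`-μGSC of `V_LJ`: the Palm law of `Q` is a
point-stationary rooted `δ`-hard-core probability law of mean root energy `e(Q)` (tree: `PeriodicPalmLaw`, `PeriodicEnergy`), the door applies,
and an almost-sure property of the Palm law holds at every motif view. [folklore] -/
theorem isMuGSC_view_of_energyPerParticle_le
    (hDoor : Summit.AtomisticToContinuum.Crystallization.Theses.GrainCoreNetworkSplit.MuEquilibriumDoor)
    {δ : ℝ} (hδ : 0 < δ) (hsep : ∀ p ∈ Q.points, ∀ q ∈ Q.points, p ≠ q → δ ≤ dist p q)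
    (hopt : Q.energyPerParticle lennardJones ≤ ⨅ Q' : PeriodicConfiguration 3, Q'.energyPerParticle lennardJones) :
    ∀ x ∈ Q.motif, IsMuGSC lennardJones (⨅ Q' : PeriodicConfiguration 3, Q'.energyPerParticle lennardJones) (view Q x) := by
  have hE : ∫ μ, rootEnergy lennardJones μ ∂(palmLaw Q) = Q.energyPerParticle lennardJones := by
    rw [← meanRootEnergy_palmLaw Q]; rfl
  have hg := hDoor δ hδ (palmLaw Q) inferInstance (rooted_palmLaw Q hsep) (pointStationary_palmLaw Q) (hE.le.trans hopt)
  have hg' : ∀ᵐ μ ∂(palmLaw Q),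
      IsMuGSC lennardJones (⨅ Q' : PeriodicConfiguration 3, Q'.energyPerParticle lennardJones) {p : E3 | μ {p} ≠ 0} :=
    hg.mono fun μ hμ => hμ
  intro x hx
  have hv := of_ae_palmLaw Q hg' x hx
  rwa [setOf_viewMeasure_ne_zero] at hv

/-- **`k`-ATOM CENSUS TEST FOR PERIODIC CANDIDATES (granted the door).**  Let `Q` be `δ`-separated periodic, `x` a motif point, and suppose a
finite surgery on `Q − x` — remove the `n` distinct atoms `xf ⊆ Q − x`, insert the `k` distinct atoms `R` off `(Q − x) ∖ xf` — has balance
`Δ = [U(R) + I(R, ·)] − [U(xf) + I(xf, ·)] < e(Q)·(k − n)`.  Then `e⋆ < e(Q)`: `Q` is not an exact Lennard-Jones minimiser.  NO bound on `e⋆`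
is needed (were `e(Q) ≤ e⋆`, then `e(Q) = e⋆` and `Q − x` would be an `e(Q)`-μGSC).  Instances: converting a ball of an A15 / σ / Laves
candidate into an hcp patch (`k ≤ n`), or any profitable `k`-atom rearrangement (`Δ < 0`, `k = n`). [folklore] -/
theorem eStar_lt_energyPerParticle_of_surgery
    (hDoor : Summit.AtomisticToContinuum.Crystallization.Theses.GrainCoreNetworkSplit.MuEquilibriumDoor)
    {δ : ℝ} (hδ : 0 < δ) (hsep : ∀ p ∈ Q.points, ∀ q ∈ Q.points, p ≠ q → δ ≤ dist p q)
    {x : E3} (hx : x ∈ Q.motif) {n : ℕ} {xf : Fin n → E3} (hxf : Function.Injective xf) (hX : Set.range xf ⊆ view Q x)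
    {k : ℕ} {R : Fin k → E3} (hR : Function.Injective R) (hdisj : Disjoint (Set.range R) (view Q x \ Set.range xf))
    (hΔ : (interactionEnergy lennardJones R + ∑ i, ∑' y : ↥(view Q x \ Set.range xf), lennardJones (dist (R i) y)) -
        (interactionEnergy lennardJones xf + ∑ i, ∑' y : ↥(view Q x \ Set.range xf), lennardJones (dist (xf i) y)) <
        Q.energyPerParticle lennardJones * ((k : ℝ) - n)) :
    (⨅ Q' : PeriodicConfiguration 3, Q'.energyPerParticle lennardJones) < Q.energyPerParticle lennardJones := by
  by_contra hle
  rw [not_lt] at hle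
  have heq : Q.energyPerParticle lennardJones = ⨅ Q' : PeriodicConfiguration 3, Q'.energyPerParticle lennardJones :=
    le_antisymm hle (eStar_le Q)
  have hG := isMuGSC_view_of_energyPerParticle_le Q hDoor hδ hsep hle x hx
  rw [← heq] at hG
  exact not_isMuGSC_of_profitable_surgery hxf hX hR hdisj hΔ hG

/-- **`e⋆`-free special case** (`k = n`): a PROFITABLE particle-conserving rearrangement of finitely many atoms of a `δ`-separated periodic
`Q` certifies `e⋆ < e(Q)`, granted the door. [folklore] -/
theorem eStar_lt_energyPerParticle_of_rearrangement
    (hDoor : Summit.AtomisticToContinuum.Crystallization.Theses.GrainCoreNetworkSplit.MuEquilibriumDoor)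
    {δ : ℝ} (hδ : 0 < δ) (hsep : ∀ p ∈ Q.points, ∀ q ∈ Q.points, p ≠ q → δ ≤ dist p q)
    {x : E3} (hx : x ∈ Q.motif) {n : ℕ} {xf : Fin n → E3} (hxf : Function.Injective xf) (hX : Set.range xf ⊆ view Q x)
    {R : Fin n → E3} (hR : Function.Injective R) (hdisj : Disjoint (Set.range R) (view Q x \ Set.range xf))
    (hΔ : interactionEnergy lennardJones R + ∑ i, ∑' y : ↥(view Q x \ Set.range xf), lennardJones (dist (R i) y) <
        interactionEnergy lennardJones xf + ∑ i, ∑' y : ↥(view Q x \ Set.range xf), lennardJones (dist (xf i) y)) :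
    (⨅ Q' : PeriodicConfiguration 3, Q'.energyPerParticle lennardJones) < Q.energyPerParticle lennardJones :=
  eStar_lt_energyPerParticle_of_surgery Q hDoor hδ hsep hx hxf hX hR hdisj (by rw [sub_self, mul_zero]; linarith)

end Periodic

end Summit.AtomisticToContinuum.Crystallization.Theorems.FrustratedLawDichotomyGSCSurgeryTests

end
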